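import Mathlib.FieldTheory.KrullTopology
import Literature.NumberTheory.EllipticCurves.IsogenyBaseChange
import Literature.NumberTheory.EllipticCurves.IsogenyGeomEndRingProofs
import HarnessLib

/-!
# `End_{K̄}(E)` is a Galois-stable ring of endomorphisms each defined over a finite extension

Theorem-only `Proofs` companion of the prelude `Literature.NumberTheory.EllipticCurves.Isogeny`
(topic `NumberTheory/EllipticCurves`), on the Galois behaviour of the geometric endomorphism ring
`W.geomEndRing = End_{K̄}(E)` of a Weierstrass curve `W` over a field `K` (the subring of
`AddMonoid.End E(K̄)` generated by the *algebraic* additive endomorphisms, those given by a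
rational map with `K̄`-coefficients off a finite set). J. H. Silverman, *The Arithmetic of
Elliptic Curves*, 2nd ed., I.§3 ("if `φ` is defined over `K̄` … `φ^σ` is the rational map obtained
by applying `σ` to the coefficients", `φ(P)^σ = φ^σ(P^σ)`; Ex. 1.12) and III.§4, §9; J.-P. Serre,
*Abelian ℓ-adic representations and elliptic curves* (1968), IV.2.2, Remark 2 (the endomorphisms
of `E` over `K̄` are defined over a finite extension of `K`).

* `WeierstrassCurve.RatRep.agrees_conj`, `WeierstrassCurve.RatRep.nonempty_ratRep_conj` — for a rational
  representation `(P₁/Q₁, P₂/Q₂)` of a map `f : E(K̄) → E'(K̄)` and `σ ∈ Γ_K`, the conjugate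
  polynomials `(P₁^σ/Q₁^σ, P₂^σ/Q₂^σ)` represent the conjugate map `f^σ : P ↦ σ f(σ⁻¹ P)`, the
  exceptional set being contained in `σ · exc`;
* `WeierstrassCurve.IsAlgebraicOn.conj` — **the Galois conjugate of an algebraic map is
  algebraic**;
* `WeierstrassCurve.conj_mem_geomEndRing` — **`End_{K̄}(E)` is stable under `Γ_K`**:
  `σ ∘ φ ∘ σ⁻¹ ∈ End_{K̄}(E)` for `φ ∈ End_{K̄}(E)` (elliptic `W`, through the honest membership
  statement `WeierstrassCurve.mem_geomEndRing_iff_holds`);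
* `MvPolynomial.map_eq_self_of_forall_mem_coeffs` — a ring endomorphism fixing the coefficients
  of a polynomial fixes the polynomial;
* `WeierstrassCurve.IsAlgebraicOn.exists_isOpen_forall_map_smul` — **an algebraic additive map
  is defined over a finite extension of `K`**: there is an open subgroup `U ≤ Γ_K` (the fixing
  subgroup of the field generated over `K` by the coefficients of a rational representation,
  open for the Krull topology, Mathlib `IntermediateField.fixingSubgroup_isOpen`) with
  `f(σ P) = σ f(P)` for all `σ ∈ U`, `P ∈ E(K̄)` (for `σ` fixing the coefficients both sides are
  additive in `P` and agree off the finite set `exc ∪ σ⁻¹ exc`, hence everywhere,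
  `Literature.NumberTheory.EllipticCurves.AddMonoidHom.eq_of_eqOn_compl_finite`);
  `WeierstrassCurve.exists_isOpen_forall_smul_comm_of_mem_geomEndRing` — the same for every
  `φ ∈ End_{K̄}(E)`.

These serve the potential-complex-multiplication case of Faltings' Satz 4 for an elliptic curve
(`Literature.AlgebraicGeometry.Motives.FaltingsECEndCorePotentialCMProofs`).

## References

* [SilvermanAEC2009] J. H. Silverman, *The Arithmetic of Elliptic Curves*, 2nd ed., GTM 106,
  Springer 2009: I.§3 (rational maps, `φ^σ`, Ex. 1.12), III.§4, III.§9.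
* [Serre1968] J.-P. Serre, *Abelian ℓ-adic representations and elliptic curves*, Benjamin 1968,
  Ch. IV §2.2, Remark 2.

## Design

Theorems only (and no instances); `noncomputable section`, `open scoped Classical`, one universe
`u`, deliberate dot-notation extensions of the tree's `WeierstrassCurve.RatRep`,
`WeierstrassCurve.IsAlgebraicOn` and of Mathlib's `MvPolynomial` namespace. The conjugate of an
additive endomorphism `φ` by `σ` is written with Mathlib's
`DistribMulAction.toAddMonoidEnd Γ_K E(K̄)` as `toAddMonoidEnd σ * φ * toAddMonoidEnd σ⁻¹`, whose
underlying function is `P ↦ σ • φ (σ⁻¹ • P)` definitionally. The open subgroup is produced inside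
`Field.absoluteGaloisGroup K = (K̄ ≃ₐ[K] K̄)` (Mathlib, Krull topology), as in
`Literature.NumberTheory.GaloisRepresentations.ArtinRestriction`.
-/

noncomputable section

open scoped Classical

universe u

namespace MvPolynomial

/-- A ring endomorphism fixing every (non-zero) coefficient of a multivariate polynomial fixes
the polynomial under `MvPolynomial.map`. [folklore] -/
theorem map_eq_self_of_forall_mem_coeffs {σ R : Type*} [CommSemiring R] {p : MvPolynomial σ R}
    {f : R →+* R} (h : ∀ c ∈ p.coeffs, f c = c) : MvPolynomial.map f p = p := by
  ext m
  rw [coeff_map]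
  by_cases hc : p.coeff m = 0
  · rw [hc, map_zero]
  · exact h _ (coeff_mem_coeffs m hc)

end MvPolynomial

namespace WeierstrassCurve

open _root_.WeierstrassCurve.geomPoints Literature.NumberTheory.EllipticCurves
open Field (absoluteGaloisGroup)

variable {K : Type u} [Field K] {W W' : WeierstrassCurve K}

/-! ## Galois conjugates of a rational representation -/

namespace RatRep

variable {f : W.geomPoints → W'.geomPoints} (ρ : RatRep W W' f)

/-- **The conjugate map agrees with the conjugate rational map at conjugates of non-exceptional
points**: for any map `f` on geometric points, `σ ∈ Γ_K` and `P₀ ∉ exc`, the conjugate map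
`f^σ : P ↦ σ • f (σ⁻¹ • P)` agrees with `(P₁^σ/Q₁^σ, P₂^σ/Q₂^σ)` at `σ • P₀`.
Silverman, *AEC*, I.§3 (`φ(P)^σ = φ^σ(P^σ)`). [folklore] -/
theorem agrees_conj (σ : absoluteGaloisGroup K) {P₀ : W.geomPoints} (hP₀ : P₀ ∉ ρ.exc) :
    AgreesWithRationalMapAt W W' (MvPolynomial.map (galHom σ) ρ.P₁)
      (MvPolynomial.map (galHom σ) ρ.Q₁) (MvPolynomial.map (galHom σ) ρ.P₂)
      (MvPolynomial.map (galHom σ) ρ.Q₂) (fun P ↦ σ • f (σ⁻¹ • P)) (σ • P₀) := by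
  rcases P₀ with _ | ⟨x, y, h⟩
  · exact (hP₀ ρ.zero_mem_exc).elim
  · obtain ⟨hQ₁, hQ₂, h', hfP⟩ := ρ.apply_eq_of_not_mem_exc h hP₀
    obtain ⟨hσ, eσ⟩ := geomPoints.smul_some (W := W) σ h
    change AgreesWithRationalMapAt W W' _ _ _ _ (fun P ↦ σ • f (σ⁻¹ • P))
      (σ • (show W.geomPoints from Affine.Point.some x y h))
    rw [eσ, agreesWithRationalMapAt_iff, xy_some]
    refine ⟨Affine.Point.some_ne_zero hσ, ?_, ?_, ?_⟩
    · rw [← galois_eval_vec₂, map_ne_zero]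
      exact hQ₁
    · rw [← galois_eval_vec₂, map_ne_zero]
      exact hQ₂
    · have e : σ • f (σ⁻¹ • (show W.geomPoints from Affine.Point.some _ _ hσ)) =
          σ • f (Affine.Point.some x y h) := by
        rw [← eσ, inv_smul_smul]
      change ∃ h'', σ • f (σ⁻¹ • (show W.geomPoints from Affine.Point.some _ _ hσ)) = _
      rw [e, hfP]
      obtain ⟨hσ', eσ'⟩ := geomPoints.smul_some (W := W') σ h'
      rw [eσ']
      exact Affine.Point.exists_eq_some_of_eq rfl
        (by rw [map_div₀, galois_eval_vec₂, galois_eval_vec₂])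
        (by rw [map_div₀, galois_eval_vec₂, galois_eval_vec₂])

include ρ in
/-- **Galois conjugates of a representation represent the conjugate map.** For `σ ∈ Γ_K` the
conjugate polynomials `(P₁^σ, Q₁^σ, P₂^σ, Q₂^σ)` represent `f^σ : P ↦ σ • f (σ⁻¹ • P)`, the
exceptional set being contained in `σ • exc` (`agrees_conj`); stated as the existence of a
rational representation of `f^σ` (this file introduces no definitions). Silverman, *AEC*, I.§3
(`φ^σ`). [folklore] -/
theorem nonempty_ratRep_conj (σ : absoluteGaloisGroup K) :
    Nonempty (RatRep W W' (fun P ↦ σ • f (σ⁻¹ • P))) :=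
  ⟨{ P₁ := MvPolynomial.map (galHom σ) ρ.P₁
     Q₁ := MvPolynomial.map (galHom σ) ρ.Q₁
     P₂ := MvPolynomial.map (galHom σ) ρ.P₂
     Q₂ := MvPolynomial.map (galHom σ) ρ.Q₂
     finite_setOf_not_agrees := by
       refine ((ρ.exc.finite_toSet).image fun P ↦ σ • P).subset fun P hP ↦ ?_
       by_contra hmem
       apply hP
       have hP₀ : σ⁻¹ • P ∉ ρ.exc := fun h ↦ hmem ⟨σ⁻¹ • P, h, smul_inv_smul σ P⟩
       simpa only [smul_inv_smul] using ρ.agrees_conj σ hP₀ }⟩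

end RatRep

/-! ## Galois conjugates of algebraic maps and of geometric endomorphisms -/

/-- **The Galois conjugate of an algebraic map is algebraic**: if `f : E(K̄) → E'(K̄)` agrees with
a rational map off a finite set, so does `f^σ : P ↦ σ • f (σ⁻¹ • P)` for every `σ ∈ Γ_K` (with the
conjugate rational map). Silverman, *AEC*, I.§3 (`φ^σ`). [folklore] -/
theorem IsAlgebraicOn.conj {f : W.geomPoints → W'.geomPoints} (hf : IsAlgebraicOn W W' f)
    (σ : absoluteGaloisGroup K) : IsAlgebraicOn W W' (fun P ↦ σ • f (σ⁻¹ • P)) := by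
  obtain ⟨ρ⟩ := isAlgebraicOn_iff_nonempty_ratRep.mp hf
  exact isAlgebraicOn_iff_nonempty_ratRep.mpr (ρ.nonempty_ratRep_conj σ)

/-- The underlying function of the conjugate `σ ∘ φ ∘ σ⁻¹` of an additive endomorphism `φ` of
`E(K̄)`, written with Mathlib's `DistribMulAction.toAddMonoidEnd`, is `P ↦ σ • φ (σ⁻¹ • P)`.
[folklore] -/
theorem toAddMonoidEnd_mul_mul_toAddMonoidEnd_inv_apply (φ : AddMonoid.End W.geomPoints)
    (σ : absoluteGaloisGroup K) (P : W.geomPoints) :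
    (DistribMulAction.toAddMonoidEnd (absoluteGaloisGroup K) W.geomPoints σ * φ *
        DistribMulAction.toAddMonoidEnd (absoluteGaloisGroup K) W.geomPoints σ⁻¹) P =
      σ • φ (σ⁻¹ • P) :=
  rfl

variable (W) in
/-- **`End_{K̄}(E)` is stable under `Γ_K`**: for an elliptic curve `E = W` over `K`, `φ ∈ End_{K̄}(E)`
and `σ ∈ Γ_K`, the conjugate `σ ∘ φ ∘ σ⁻¹` lies in `End_{K̄}(E)`. By the honest description of
`End_{K̄}(E)` (`WeierstrassCurve.mem_geomEndRing_iff_holds`: zero or algebraic) and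
`IsAlgebraicOn.conj`. Silverman, *AEC*, I.§3 and III.§4 (`Gal(K̄/K)` acts on `Hom(E₁, E₂)`,
cf. VIII.§1). [folklore] -/
theorem conj_mem_geomEndRing [W.IsElliptic] {φ : AddMonoid.End W.geomPoints}
    (hφ : φ ∈ W.geomEndRing) (σ : absoluteGaloisGroup K) :
    DistribMulAction.toAddMonoidEnd (absoluteGaloisGroup K) W.geomPoints σ * φ *
        DistribMulAction.toAddMonoidEnd (absoluteGaloisGroup K) W.geomPoints σ⁻¹ ∈
      W.geomEndRing := by
  rcases (mem_geomEndRing_iff_holds W φ).mp hφ with rfl | halg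
  · rw [mul_zero, zero_mul]
    exact W.geomEndRing.zero_mem
  · exact Subring.subset_closure (halg.conj σ)

/-! ## An algebraic map is defined over a finite extension -/

/-- **An algebraic additive map commutes with an open subgroup of `Γ_K`** (it is defined over a
finite extension of `K`): for an elliptic curve `E = W` and an additive `f : E(K̄) → E'(K̄)`
agreeing with a rational map `(P₁/Q₁, P₂/Q₂)` off a finite set, let `U = Gal(K̄/K(C)) ≤ Γ_K` be
the fixing subgroup of the field generated by the (finitely many) coefficients `C` of
`P₁, Q₁, P₂, Q₂` — open for the Krull topology. For `σ ∈ U` the polynomials are `σ`-invariant,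
so `f(σ P) = σ f(P)` at every `P` with `P, σ P ∉ exc` (Silverman, *AEC*, I.§3:
`φ(P)^σ = φ^σ(P^σ) = φ(P^σ)`); both sides being additive in `P` and `E(K̄)` infinite, they agree
everywhere. [folklore] -/
theorem IsAlgebraicOn.exists_isOpen_forall_map_smul [W.IsElliptic]
    {f : W.geomPoints →+ W'.geomPoints} (hf : IsAlgebraicOn W W' f) :
    ∃ U : Subgroup (absoluteGaloisGroup K), IsOpen (U : Set (absoluteGaloisGroup K)) ∧
      ∀ σ ∈ U, ∀ P : W.geomPoints, f (σ • P) = σ • f P := by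
  obtain ⟨ρ⟩ := isAlgebraicOn_iff_nonempty_ratRep.mp hf
  -- the field generated by the coefficients and its (open) fixing subgroup
  let C : Finset (AlgebraicClosure K) := ρ.P₁.coeffs ∪ ρ.Q₁.coeffs ∪ ρ.P₂.coeffs ∪ ρ.Q₂.coeffs
  let E : IntermediateField K (AlgebraicClosure K) :=
    IntermediateField.adjoin K (C : Set (AlgebraicClosure K))
  haveI : FiniteDimensional K E :=
    IntermediateField.finiteDimensional_adjoin fun x _ ↦ Algebra.IsIntegral.isIntegral x
  refine ⟨(E.fixingSubgroup : Subgroup (absoluteGaloisGroup K)), E.fixingSubgroup_isOpen,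
    fun σ hσ ↦ ?_⟩
  -- `σ` fixes the coefficients, hence the four polynomials
  have hfix : ∀ c ∈ C, RatRep.galHom σ c = c := fun c hc ↦
    (IntermediateField.mem_fixingSubgroup_iff E _).mp hσ c (IntermediateField.subset_adjoin K _ hc)
  have hP₁ : MvPolynomial.map (RatRep.galHom σ) ρ.P₁ = ρ.P₁ :=
    MvPolynomial.map_eq_self_of_forall_mem_coeffs fun c hc ↦ hfix c (by simp [C, hc])
  have hQ₁ : MvPolynomial.map (RatRep.galHom σ) ρ.Q₁ = ρ.Q₁ :=
    MvPolynomial.map_eq_self_of_forall_mem_coeffs fun c hc ↦ hfix c (by simp [C, hc])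
  have hP₂ : MvPolynomial.map (RatRep.galHom σ) ρ.P₂ = ρ.P₂ :=
    MvPolynomial.map_eq_self_of_forall_mem_coeffs fun c hc ↦ hfix c (by simp [C, hc])
  have hQ₂ : MvPolynomial.map (RatRep.galHom σ) ρ.Q₂ = ρ.Q₂ :=
    MvPolynomial.map_eq_self_of_forall_mem_coeffs fun c hc ↦ hfix c (by simp [C, hc])
  -- agreement off the finite set `exc ∪ σ⁻¹ exc`
  have key : ∀ P ∉ ((ρ.exc : Set W.geomPoints) ∪ (fun Q ↦ σ⁻¹ • Q) '' (ρ.exc : Set W.geomPoints)),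
      f (σ • P) = σ • f P := by
    intro P hP
    rw [Set.mem_union, not_or] at hP
    obtain ⟨hP₀, hPσ⟩ := hP
    have hσP : σ • P ∉ ρ.exc := fun h ↦ hPσ ⟨σ • P, h, inv_smul_smul σ P⟩
    rcases P with _ | ⟨x, y, h⟩
    · exact (hP₀ ρ.zero_mem_exc).elim
    · obtain ⟨-, -, h', hfP⟩ := ρ.apply_eq_of_not_mem_exc h hP₀
      obtain ⟨hσ, eσ⟩ := geomPoints.smul_some (W := W) σ h
      change f (σ • (show W.geomPoints from Affine.Point.some x y h)) =
        σ • f (Affine.Point.some x y h)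
      rw [eσ] at hσP ⊢
      obtain ⟨-, -, h'', hfσP⟩ := ρ.apply_eq_of_not_mem_exc hσ hσP
      rw [hfσP, hfP]
      obtain ⟨hσ', eσ'⟩ := geomPoints.smul_some (W := W') σ h'
      rw [eσ']
      obtain ⟨h₃, e₃⟩ := Affine.Point.exists_eq_some_of_eq (P := (Affine.Point.some _ _ hσ' :
          W'.geomPoints)) rfl
        (by rw [map_div₀, RatRep.galois_eval_vec₂, RatRep.galois_eval_vec₂, hP₁, hQ₁])
        (by rw [map_div₀, RatRep.galois_eval_vec₂, RatRep.galois_eval_vec₂, hP₂, hQ₂])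
      exact e₃.symm
  -- two additive maps agreeing off a finite set of the infinite group `E(K̄)` are equal
  have hfin : ((ρ.exc : Set W.geomPoints) ∪
      (fun Q ↦ σ⁻¹ • Q) '' (ρ.exc : Set W.geomPoints)).Finite :=
    ρ.exc.finite_toSet.union (ρ.exc.finite_toSet.image _)
  have heq := AddMonoidHom.eq_of_eqOn_compl_finite
    (f := f.comp (DistribSMul.toAddMonoidHom W.geomPoints σ))
    (g := (DistribSMul.toAddMonoidHom W'.geomPoints σ).comp f) hfin
    fun P hP ↦ key P hP
  intro P
  exact congr($heq P)

variable (W) in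
/-- **Every geometric endomorphism commutes with an open subgroup of `Γ_K`**: for an elliptic
curve `E = W` over `K` and `φ ∈ End_{K̄}(E)` there is an open subgroup `U ≤ Γ_K` with
`φ (σ • P) = σ • φ P` for all `σ ∈ U`, `P ∈ E(K̄)` — i.e. `φ` is defined over the finite extension
`K̄^U` of `K` (Serre 1968, IV.2.2, Remark 2; Silverman, *AEC*, III.§9 with I.§3).
[cite: Serre1968, Ch. IV §2.2, Remark 2] -/
theorem exists_isOpen_forall_smul_comm_of_mem_geomEndRing [W.IsElliptic]
    {φ : AddMonoid.End W.geomPoints} (hφ : φ ∈ W.geomEndRing) :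
    ∃ U : Subgroup (absoluteGaloisGroup K), IsOpen (U : Set (absoluteGaloisGroup K)) ∧
      ∀ σ ∈ U, ∀ P : W.geomPoints, φ (σ • P) = σ • φ P := by
  rcases (mem_geomEndRing_iff_holds W φ).mp hφ with rfl | halg
  · exact ⟨⊤, isOpen_univ, fun σ _ P ↦ (smul_zero σ).symm⟩
  · exact IsAlgebraicOn.exists_isOpen_forall_map_smul (f := (φ : W.geomPoints →+ W.geomPoints))
      halg

end WeierstrassCurve
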